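import Summits.KontsevichZagierPeriods.KontsevichZagierPeriods.Theses.CobordismMove

/-!
# Route CobordismMove — `Assembly`: the route's engines and target imply the summit statement

Problem `KontsevichZagierPeriods`, route `CobordismMove`, item stmt-KontsevichZagierPeriods-5571
(`Assembly`, assembly, rank 1). The route declaration `Assembly` is the curried implication
`CubeStokes → SignedSheetTransfer → TopologicalMovesKernel → KontsevichZagierPeriods`:

* `CubeStokes` (closed-form Stokes on the unit cube: the signed sum of the `2(d+1)` face
  representations of a closed `ℚ`-semialgebraic coefficient system lies in `KZ.relations`) and
  `SignedSheetTransfer` (a finite-sheeted `ℚ`-semialgebraic map with orientation signs and constant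
  signed sheet count `D` gives `[r] - D • [r'] ∈ KZ.relations`) put the two relator families of the
  route INSIDE `KZ.relations`;
* the four move sets are inside `KZ.relations` by `KZ.*_subset_relations`, so
  `AddSubgroup.closure_le` bounds the enlarged closure (moves ∪ cube-Stokes relators ∪ signed-sheet
  relators) by `KZ.relations`;
* `TopologicalMovesKernel` (the kernel conjecture of the enlarged calculus) then yields the plain
  kernel form of Conjecture 1, and for two representations `r, r'` with equal values
  `KZ.eval ([r] - [r']) = value r - value r' = 0`, so `[r] - [r'] ∈ KZ.relations`, i.e.
  `KZ.Equivalent r r'` — the summit statement `KontsevichZagierPeriods` (two rational-shape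
  integral representations with equal values are equivalent under the moves); the rationality
  hypotheses are not used.

This is the type of the route's deciding theorem `CobordismMove.closes`; the proof below is kept
self-contained (pure algebra of `AddSubgroup.closure`, 15 lines) so that it depends only on the
three route definitions and the `KZCalculus` API, not on the current shape of `closes`.

Sources: M. Kontsevich, D. Zagier, *Periods* (2001), §1.2 (Conjecture 1 and its kernel
reformulation); A. Huber, S. Müller-Stach, *Periods and Nori Motives* (2017), §13.1. Deliberately
NOT here: any claim about the three hypotheses themselves (two are the route's cruxes, the third is
its GPC-strength target) — the result is the implication only, unconditional as an implication.
-/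

namespace Summit.KontsevichZagierPeriods.CobordismMove

open Literature.NumberTheory.Transcendental

/-- Settles stmt-KontsevichZagierPeriods-5571: the route declaration `CobordismMove.Assembly`
(`CubeStokes → SignedSheetTransfer → TopologicalMovesKernel → KontsevichZagierPeriods`) holds.
Given `r, r'` with `value r = value r'`, `KZ.eval ([r] - [r']) = 0`, so `TopologicalMovesKernel`
places `[r] - [r']` in the closure of (the four moves ∪ cube-Stokes relators ∪ signed-sheet
relators); every generator of that closure is a relation — the moves by `KZ.*_subset_relations`,
the cube-Stokes relators by `CubeStokes`, the signed-sheet relators by `SignedSheetTransfer` — so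
`AddSubgroup.closure_le` gives `[r] - [r'] ∈ KZ.relations`, i.e. `KZ.Equivalent r r'`.
[Kontsevich–Zagier 2001, §1.2] [folklore] -/
theorem assembly_proof :
    Summit.KontsevichZagierPeriods.KontsevichZagierPeriods.Theses.CobordismMove.Assembly := by
  unfold Summit.KontsevichZagierPeriods.KontsevichZagierPeriods.Theses.CobordismMove.Assembly
  intro h₁ h₂ h₃ n m r r' _ _ hv
  have h0 : KZ.eval (KZ.of r - KZ.of r') = 0 := by
    rw [map_sub, KZ.eval_of, KZ.eval_of, hv, sub_self]
  refine (AddSubgroup.closure_le _).mpr ?_ (h₃ _ h0)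
  rintro e (((((he | he) | he) | he) | he) | he)
  · exact KZ.domainAddRel_subset_relations he
  · exact KZ.integrandAddRel_subset_relations he
  · exact KZ.changeOfVariablesRel_subset_relations he
  · exact KZ.newtonLeibnizRel_subset_relations he
  · obtain ⟨d, A, A', rf, hA, hA', hcont, hder, hint, hclosed, hdom, hface, rfl⟩ := he
    exact h₁ d A A' rf hA hA' hcont hder hint hclosed hdom hface
  · obtain ⟨k, N, D, ρ, ρ', ε, σ, Φ, Φ', hε, hσ, hsub, hnull, hmap, hder, hinj, himg, hcount, hintg,
      rfl⟩ := he
    exact h₂ k N D ρ ρ' ε σ Φ Φ' hε hσ hsub hnull hmap hder hinj himg hcount hintg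

end Summit.KontsevichZagierPeriods.CobordismMove
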